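import Summits.CriticalPhenomena.PercolationContinuityZ3.Theorems.PercNearOneGluingNoHeavyLowerTailEventGluingSharp
import HarnessLib

/-!
# The footprint lower tail of any observer is dominated by the worst relay point's own block lower tail

builds on p205010 (kernel theorem, internal audit signed; external expert review pending)

PAPER-2 track "percolation constants", part (ii), seat `prim-consts-1` (lane index `run/shared/lean/prim/consts/CONSTANTS.md`,
row A17(b); memo `FROM-prim-consts-1-g2-RATE-WINDOW.md`).  Support file for the crux `NoHeavyLowerTail` (stmt-CriticalPhenomena-4575;
`--supports … --as helper`): theorems only, no definitions, no sorries, standard axioms.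

Notation: finite weighted graph on `Fin n`, relay set `A`, observer `o`; `N = N_o = |C(o) ∩ A|` (the footprint of `o` in `A`), and for
a relay point `a ∈ A`, `N_a = |C(a) ∩ A| ≥ 1` (the relay mass of `a`'s own block).

* `Consts.footprint_tail_transfer` — **(GEN) at the threshold functional**: for every `k`,
    `μ(o ↔ A) · min_{a ∈ A} μ(N_a ≥ k) ≤ μ(o ↔ A, N_o ≥ k)`.
  This is the tree's master inequality (GEN) (`EventGluingSharp.gen_holds`: `Σ_a μ(P_a)·E F(C(a)) ≤ ∫_{o↔A} F(C(o))` for monotone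
  nonnegative cluster functionals `F`, first-in-rank patterns `P_a` partitioning `{o ↔ A}`) at `F(S) = 1{|S ∩ A| ≥ k}` — the same
  one-line specialisation by which `EventGluingSharp.jointGluing_holds` obtains Kozma–Nitzan's Conjecture 1 from `F = 1{b ∈ S}`.
* `Consts.lowerTail_le_blockDeficit` — consequently, if `μ(N_a < k) ≤ s'` for every `a ∈ A`, then
    `μ(1 ≤ N_o < k) ≤ s' · μ(o ↔ A) ≤ s'`:
  THE LOWER TAIL OF THE FOOTPRINT OF AN ARBITRARY OBSERVER IS NO WORSE THAN THE WORST RELAY POINT'S BLOCK DEFICIT TAIL.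
  In particular the sharp reach-free linear lower-tail constant `C(κ) = sup P(1 ≤ N < κ·EN)/s` (rows A17(b); kernel window for the
  linear rate of the crux `[1/2, 2/3]`) is attained with the observer a relay point (`o ∈ A`, where `N ≥ 1` is automatic): the
  conjecture `C(κ) = (1+b)/2` is a statement about one relay point's block inside a pairwise-reliable relay set.
(With Markov for the block deficit, `(|A| + 1 − k)·μ(N_a < k) ≤ Σ_b μ(a ↮ b) ≤ |A|·s`, the transfer re-derives the `s/(1−κ)` bound
of `…ConstsNoHeavyRateHalf` without the one-cut form of `AdditiveGluing`; not repeated here.)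
References: G. Kozma, N. Nitzan, arXiv:2401.12397 (2024), Conj. 1, Conj. 4 (p. 32); J. van den Berg, O. Häggström, J. Kahn,
Random Struct. Alg. 29 (2006), Thm. 1.3.
-/

noncomputable section

namespace Summit.CriticalPhenomena.PercolationContinuityZ3.Theorems

open MeasureTheory Set Literature.Probability.LatticeModels Literature.Probability.Percolation
open scoped Classical

namespace Consts

/-- **(GEN) at the threshold functional `F = 1{|C ∩ A| ≥ k}`**: if `t ≤ μ(N_a ≥ k)` for every relay point `a ∈ A`, then
`μ(o ↔ A)·t ≤ μ({o ↔ A} ∩ {N_o ≥ k})`. [cite: KozmaNitzan2024, Conj. 4 (p. 32)] -/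
theorem footprint_tail_transfer (n : ℕ) (w : Sym2 (Fin n) → unitInterval) (A : Finset (Fin n)) (o : Fin n) (k : ℕ) (t : ℝ)
    (ht : ∀ a ∈ A, t ≤ (prodBernoulli w).real
      {ω : BondConfig (Fin n) | k ≤ (A.filter fun b => ω ∈ openConn a b).card}) :
    (prodBernoulli w).real (⋃ a ∈ A, openConn o a) * t ≤
      (prodBernoulli w).real ((⋃ a ∈ A, openConn o a) ∩
        {ω : BondConfig (Fin n) | k ≤ (A.filter fun b => ω ∈ openConn o b).card}) := by
  set μ := prodBernoulli w with hμ
  have hmeas : ∀ S : Set (BondConfig (Fin n)), MeasurableSet S := fun S => (Set.toFinite S).measurableSet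
  -- the cluster functional `F = 1{|S ∩ A| ≥ k}`
  set F : Set (Fin n) → ℝ := fun S => if k ≤ (A.filter fun b => b ∈ S).card then 1 else 0 with hFdef
  have hFmono : ∀ S T : Set (Fin n), S ⊆ T → F S ≤ F T := by
    intro S T hST
    simp only [hFdef]
    by_cases hS : k ≤ (A.filter fun b => b ∈ S).card
    · have hT : k ≤ (A.filter fun b => b ∈ T).card :=
        hS.trans (Finset.card_le_card (Finset.monotone_filter_right A fun b _ hb => hST hb))
      rw [if_pos hS, if_pos hT]
    · rw [if_neg hS]
      split_ifs <;> norm_num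
  have hF0 : ∀ S, 0 ≤ F S := by
    intro S
    simp only [hFdef]
    split_ifs <;> norm_num
  have hFind : ∀ x : Fin n, (fun ω : BondConfig (Fin n) => F (openCluster ω x)) =
      ({ω : BondConfig (Fin n) | k ≤ (A.filter fun b => ω ∈ openConn x b).card}).indicator 1 := by
    intro x
    funext ω
    have hfilt : (A.filter fun b => b ∈ openCluster ω x) = A.filter fun b => ω ∈ openConn x b :=
      Finset.filter_congr fun b _ => Iff.rfl
    simp only [hFdef, hfilt]
    by_cases hω : ω ∈ ({ω : BondConfig (Fin n) | k ≤ (A.filter fun b => ω ∈ openConn x b).card})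
    · rw [Set.indicator_of_mem hω, Pi.one_apply, if_pos (by simpa using hω)]
    · rw [Set.indicator_of_notMem hω, if_neg (by simpa using hω)]
  have hint : ∀ x : Fin n, ∫ ω, F (openCluster ω x) ∂μ =
      μ.real {ω : BondConfig (Fin n) | k ≤ (A.filter fun b => ω ∈ openConn x b).card} := by
    intro x
    rw [hFind x, integral_indicator_one (hmeas _)]
  have hsetint : ∫ ω in (⋃ a ∈ A, openConn o a), F (openCluster ω o) ∂μ =
      μ.real ((⋃ a ∈ A, openConn o a) ∩
        {ω : BondConfig (Fin n) | k ≤ (A.filter fun b => ω ∈ openConn o b).card}) := by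
    rw [hFind o, ← integral_indicator (hmeas _), Set.indicator_indicator, integral_indicator_one ((hmeas _).inter (hmeas _))]
  -- a compatible injective rank
  obtain ⟨r, hr, hrc⟩ := AGloc.exists_rank_compat A (fun a => μ.real
    {ω : BondConfig (Fin n) | k ≤ (A.filter fun b => ω ∈ openConn a b).card})
  have hcompat : ∀ a ∈ A, ∀ a' ∈ A, r a < r a' →
      ∫ ω, F (openCluster ω a) ∂μ ≤ ∫ ω, F (openCluster ω a') ∂μ := by
    intro a ha a' ha' hlt
    rw [hint a, hint a']
    exact hrc a ha a' ha' hlt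
  have key := EventGluingSharp.gen_holds n w A o F r hFmono hF0 hr hcompat
  rw [← hμ] at key
  simp only [hint] at key
  rw [hsetint] at key
  -- `Σ_a μ(P_a)·μ(N_a ≥ k) ≥ t·Σ_a μ(P_a) = t·μ(o ↔ A)`
  have hsum := AGloc.sum_measureReal_firstRank w A r o hr
  rw [← hμ] at hsum
  have hlow : ∑ a ∈ A, μ.real (openConn o a ∩ ⋂ a' ∈ A.filter (fun a' => r a' < r a), (openConn o a')ᶜ :
        Set (BondConfig (Fin n))) * t ≤
      ∑ a ∈ A, μ.real (openConn o a ∩ ⋂ a' ∈ A.filter (fun a' => r a' < r a), (openConn o a')ᶜ :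
        Set (BondConfig (Fin n))) * μ.real {ω : BondConfig (Fin n) | k ≤ (A.filter fun b => ω ∈ openConn a b).card} :=
    Finset.sum_le_sum fun a ha => mul_le_mul_of_nonneg_left (ht a ha) measureReal_nonneg
  rw [← Finset.sum_mul, hsum] at hlow
  exact hlow.trans key

/-- **The footprint lower tail is dominated by the worst block-deficit tail.**  If `μ(N_a < k) ≤ s'` for every relay point `a ∈ A`,
then `μ(1 ≤ N_o < k) ≤ s'·μ(o ↔ A)` for every observer `o` (so `≤ s'`). [cite: KozmaNitzan2024, Conj. 4 (p. 32)] -/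
theorem lowerTail_le_blockDeficit (n : ℕ) (w : Sym2 (Fin n) → unitInterval) (A : Finset (Fin n)) (o : Fin n) (k : ℕ) (s' : ℝ)
    (hs : ∀ a ∈ A, (prodBernoulli w).real
      {ω : BondConfig (Fin n) | (A.filter fun b => ω ∈ openConn a b).card < k} ≤ s') :
    (prodBernoulli w).real {ω : BondConfig (Fin n) | 1 ≤ (A.filter fun b => ω ∈ openConn o b).card ∧
        (A.filter fun b => ω ∈ openConn o b).card < k} ≤
      s' * (prodBernoulli w).real (⋃ a ∈ A, openConn o a) := by
  set μ := prodBernoulli w with hμ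
  have hmeas : ∀ S : Set (BondConfig (Fin n)), MeasurableSet S := fun S => (Set.toFinite S).measurableSet
  set U : Set (BondConfig (Fin n)) := ⋃ a ∈ A, openConn o a with hU
  set G : Set (BondConfig (Fin n)) := {ω | k ≤ (A.filter fun b => ω ∈ openConn o b).card} with hG
  -- complement form of the hypothesis: `1 - s' ≤ μ(N_a ≥ k)`
  have ht : ∀ a ∈ A, 1 - s' ≤ μ.real {ω : BondConfig (Fin n) | k ≤ (A.filter fun b => ω ∈ openConn a b).card} := by
    intro a ha
    have hc : μ.real {ω : BondConfig (Fin n) | k ≤ (A.filter fun b => ω ∈ openConn a b).card} =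
        1 - μ.real {ω : BondConfig (Fin n) | (A.filter fun b => ω ∈ openConn a b).card < k} := by
      have hset : {ω : BondConfig (Fin n) | k ≤ (A.filter fun b => ω ∈ openConn a b).card} =
          {ω : BondConfig (Fin n) | (A.filter fun b => ω ∈ openConn a b).card < k}ᶜ := by
        ext ω; simp only [mem_setOf_eq, mem_compl_iff, not_lt]
      rw [hset, measureReal_compl (hmeas _), probReal_univ]
    rw [hc]
    linarith [hs a ha]
  have key := footprint_tail_transfer n w A o k (1 - s') ht
  -- the event is `U \ G`
  have hevent : {ω : BondConfig (Fin n) | 1 ≤ (A.filter fun b => ω ∈ openConn o b).card ∧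
      (A.filter fun b => ω ∈ openConn o b).card < k} = U \ (U ∩ G) := by
    ext ω
    simp only [hU, hG, mem_sdiff, mem_inter_iff, mem_setOf_eq, mem_iUnion, not_and, not_le, exists_prop]
    constructor
    · rintro ⟨h1, h2⟩
      obtain ⟨a, ha⟩ := Finset.card_pos.1 h1
      rw [Finset.mem_filter] at ha
      exact ⟨⟨a, ha.1, ha.2⟩, fun _ => h2⟩
    · rintro ⟨⟨a, ha, hω⟩, h2⟩
      exact ⟨Finset.card_pos.2 ⟨a, Finset.mem_filter.2 ⟨ha, hω⟩⟩, h2 ⟨a, ha, hω⟩⟩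
  rw [hevent, measureReal_sdiff inter_subset_left (hmeas _) (measure_ne_top _ _)]
  linarith

end Consts

end Summit.CriticalPhenomena.PercolationContinuityZ3.Theorems
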